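import Literature.AlgebraicGeometry.Resolution.QuasiProjectiveResolution
import Mathlib.AlgebraicGeometry.Morphisms.Proper
import HarnessLib

/-!
# Transport step for the crux `FrobeniusLadder.FRationalResolution` (line `Sketch`)

Stub `stub_transport` of the skeleton `Sketch` for crux stmt-ResolutionOfSingularities-15317: if every
separated finite-type `k`-scheme whose stalks satisfy the crux's F-rational clause (every stalk a
domain in which every ideal generated by a system of parameters is tightly closed, inline form) has a
resolution of singularities, then every separated finite-type `X/k` admitting an F-rational proper
birational model `π : X' → X` has one. The model `X'` is again separated of finite type over `k`
through `π ≫ f` (`π` proper: separated, universally closed hence quasi-compact, locally of finite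
type; all three classes are stable under composition), and proper birational morphisms transport
resolutions (`Literature.AlgebraicGeometry.Resolution.Scheme.HasResolution.of_isBirational`).
-/

set_option linter.dupNamespace false

noncomputable section

open CategoryTheory AlgebraicGeometry TopologicalSpace Literature.AlgebraicGeometry.Resolution

namespace Summit.ResolutionOfSingularities.ResolutionOfSingularities.Theorems.FRationalResolution.Transport

/-- TRANSPORT: if every separated finite-type `k`-scheme whose stalks satisfy the crux's F-rational
clause has a resolution, then every separated finite-type `X/k` admitting an F-rational proper
birational model has one (`Scheme.HasResolution.of_isBirational`; the model is separated of finite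
type over `k` through `π ≫ f`, `π` proper). -/
theorem stub_transport (p : ℕ) (k : Type) [Field k] (X : Scheme.{0}) (f : X ⟶ Spec (.of k))
    [IsSeparated f] [LocallyOfFiniteType f] [QuasiCompact f]
    (hcore : ∀ (X' : Scheme.{0}) (g : X' ⟶ Spec (.of k)), IsSeparated g → LocallyOfFiniteType g →
      QuasiCompact g →
      (∀ x : X', IsDomain (X'.presheaf.stalk x) ∧ ∀ d : ℕ, ringKrullDim (X'.presheaf.stalk x) = d →
        ∀ s : Fin d → X'.presheaf.stalk x, (Ideal.span (Set.range s)).radical.IsMaximal →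
        ∀ y c : X'.presheaf.stalk x, c ≠ 0 →
        (∀ e : ℕ, c * y ^ p ^ e ∈ Ideal.span ((fun z : X'.presheaf.stalk x => z ^ p ^ e) ''
          (Ideal.span (Set.range s) : Set (X'.presheaf.stalk x)))) → y ∈ Ideal.span (Set.range s)) →
      Scheme.HasResolution X')
    (hmodel : ∃ (X' : Scheme.{0}) (π : X' ⟶ X), IsProper π ∧ IsBirational π ∧
      ∀ x : X', IsDomain (X'.presheaf.stalk x) ∧ ∀ d : ℕ, ringKrullDim (X'.presheaf.stalk x) = d →
        ∀ s : Fin d → X'.presheaf.stalk x, (Ideal.span (Set.range s)).radical.IsMaximal →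
        ∀ y c : X'.presheaf.stalk x, c ≠ 0 →
        (∀ e : ℕ, c * y ^ p ^ e ∈ Ideal.span ((fun z : X'.presheaf.stalk x => z ^ p ^ e) ''
          (Ideal.span (Set.range s) : Set (X'.presheaf.stalk x)))) → y ∈ Ideal.span (Set.range s)) :
    Scheme.HasResolution X := by
  obtain ⟨X', π, hπ, hbir, hFR⟩ := hmodel
  haveI := hπ
  exact Scheme.HasResolution.of_isBirational π hbir
    (hcore X' (π ≫ f) inferInstance inferInstance inferInstance hFR)

end Summit.ResolutionOfSingularities.ResolutionOfSingularities.Theorems.FRationalResolution.Transport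

end
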